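import Literature.Analysis.FluidPDE.KNSSMollifiedWeak
import Literature.Analysis.FluidPDE.NSBoundedMildOseenDuhamel
import Literature.Analysis.FluidPDE.PressureReconstruction
import Literature.Analysis.UnboundedOperators.HeatIteratedDerivBounds
import HarnessLib

/-!
# Integration by parts of bounded smooth fields against caloric test fields

Analysis/FluidPDE proofs file on the discharge path of KNSS 2009, Lemma 3.1 (bounded weak
solutions are drift-mild; Koch–Nadirashvili–Seregin–Šverák, Acta Math. 203 (2009) =
arXiv:0709.3599v1, §3). The duality argument that turns the (mollified) equation
`∂ₜV − νΔV + div W = −∇q` into the two-time caloric identity tests with the caloric fields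
`Ψ = e^{θΔ}φ` of a smooth compactly supported (divergence-free) `φ`, which are **not** compactly
supported. This file proves the three integrations by parts this requires, for bounded smooth
fields with bounded derivatives — no decay of the field and no cut-off are needed, because the
heat semigroup is symmetric on `L^∞ × L¹` (`integral_inner_heatExtension_comm_of_bound`) and
commutes with derivatives both of bounded smooth data (`fderiv_heatExtension_of_bounded`,
`laplacian_heatExtension_of_bounded`) and of compactly supported data, so that every
integration by parts is performed against the compactly supported `φ` itself:

* `integral_inner_laplacian_heatExtension_comm_of_bounded` — **Green's identity against a caloric
  field**: `∫ ⟪ΔV, e^{θΔ}φ⟫ = ∫ ⟪V, Δ e^{θΔ}φ⟫` for `V ∈ C²` with `V, DV, D²V` bounded;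
* `integral_inner_sum_fderiv_eq_neg` / `integral_inner_sum_fderiv_heatExtension_eq_neg` — **the
  divergence of a tensor against a compactly supported / a caloric field**: `∫ ⟪Σᵢ ∂ᵢ(W eᵢ), e^{θΔ}φ⟫ = −∫ frobeniusPairing E (D e^{θΔ}φ) W` for
  `W ∈ C¹(E; E →L[ℝ] E)` with `W, DW` bounded;
* `integral_inner_heatExtension_eq_zero_of_fderiv_symm` — **a bounded curl-free field is
  orthogonal to the caloric extension of solenoidal tests**: if `G ∈ C¹` with `G, DG` bounded and
  `DG` symmetric, then `∫ ⟪G, e^{θΔ}φ⟫ = 0` for divergence-free `φ` (the heat flow of `G` has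
  again a symmetric derivative, hence is a gradient by Poincaré's lemma with the segment
  potential, `hasGradientAt_segmentIntegral`, and gradients of `C¹` functions are orthogonal to
  compactly supported solenoidal fields).

These are the steps "`∫∫ u(φ_t + Δφ) = ∫∫ f_k φ,_k`, …, by duality" of KNSS §3 p. 7 for the
smooth mollified solution, in the caloric-test form of Fabes–Jones–Rivière 1972, Thm. 2.1.
Everything is proved, in any finite-dimensional `E`.

## References

* G. Koch, N. Nadirashvili, G. Seregin, V. Šverák, Acta Math. 203 (2009) = arXiv:0709.3599v1,
  §3 p. 7. [KochNadirashviliSereginSverak2009]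
* E. B. Fabes, B. F. Jones, N. M. Rivière, Arch. Rational Mech. Anal. 45 (1972), Thm. 2.1.
  [FabesJonesRiviere1972]
* P. G. Lemarié-Rieusset, *The Navier–Stokes Problem in the 21st Century* (2016), §6.2
  (derivatives commute with the heat kernel).
-/

noncomputable section

open MeasureTheory TopologicalSpace Set Function Filter InnerProductSpace Metric
open _root_.Topology
open scoped ENNReal NNReal Laplacian RealInnerProductSpace ContDiff

namespace Literature.Analysis.FluidPDE

open UnboundedOperators (heatKernel heatExtension)

variable {E : Type*} [NormedAddCommGroup E] [InnerProductSpace ℝ E] [FiniteDimensional ℝ E]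
  [MeasurableSpace E] [BorelSpace E]

/-! ### Green's identity against a caloric field -/

omit [MeasurableSpace E] [BorelSpace E] in
/-- `‖Δ V(x)‖ ≤ (dim E) C₂` when `‖D(DV)‖ ≤ C₂`. [folklore] -/
theorem norm_laplacian_le_of_norm_fderiv_fderiv_le {V : E → E} (hV : ContDiff ℝ 2 V) {C₂ : ℝ}
    (h2 : ∀ z, ‖fderiv ℝ (fderiv ℝ V) z‖ ≤ C₂) (x : E) :
    ‖(Δ V) x‖ ≤ Module.finrank ℝ E * C₂ := by
  set b := stdOrthonormalBasis ℝ E with hb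
  have hd : DifferentiableAt ℝ (fderiv ℝ V) x :=
    ((hV.fderiv_right (m := 1) le_rfl).differentiable one_ne_zero) x
  rw [laplacian_eq_iteratedFDeriv_orthonormalBasis V b]
  calc ‖∑ i, iteratedFDeriv ℝ 2 V x ![b i, b i]‖ ≤ ∑ i, ‖iteratedFDeriv ℝ 2 V x ![b i, b i]‖ :=
        norm_sum_le _ _
    _ ≤ ∑ _i : Fin (Module.finrank ℝ E), C₂ := Finset.sum_le_sum fun i _ => by
        rw [iteratedFDeriv_two_apply]
        simp only [Matrix.cons_val_zero, Matrix.cons_val_one]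
        calc ‖fderiv ℝ (fderiv ℝ V) x (b i) (b i)‖ ≤ ‖fderiv ℝ (fderiv ℝ V) x (b i)‖ * ‖b i‖ :=
              ContinuousLinearMap.le_opNorm _ _
          _ ≤ ‖fderiv ℝ (fderiv ℝ V) x‖ * ‖b i‖ * ‖b i‖ := by
              gcongr; exact ContinuousLinearMap.le_opNorm _ _
          _ ≤ C₂ := by rw [b.orthonormal.1 i, mul_one, mul_one]; exact h2 x
    _ = Module.finrank ℝ E * C₂ := by simp

/-- **Green's identity against a caloric field.** For `V ∈ C²(E; E)` with `V`, `DV`, `D(DV)`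
bounded, `φ ∈ C²_c(E; E)` and `0 < θ`:
`∫ ⟪ΔV, e^{θΔ}φ⟫ = ∫ ⟪V, Δ(e^{θΔ}φ)⟫`
(move `e^{θΔ}` across by symmetry, commute it with `Δ` on the bounded side, Green's identity
against the compactly supported `φ`, move back, commute `Δ` with `e^{θΔ}` on the test side).
[cite: FabesJonesRiviere1972, Thm. 2.1 (proof, the caloric test)] -/
theorem integral_inner_laplacian_heatExtension_comm_of_bounded {V : E → E} (hV : ContDiff ℝ 2 V)
    {C₀ C₁ C₂ : ℝ} (h0 : ∀ z, ‖V z‖ ≤ C₀) (h1 : ∀ z, ‖fderiv ℝ V z‖ ≤ C₁)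
    (h2 : ∀ z, ‖fderiv ℝ (fderiv ℝ V) z‖ ≤ C₂) {φ : E → E} (hφ : ContDiff ℝ 2 φ)
    (hφc : HasCompactSupport φ) {θ : ℝ} (hθ : 0 < θ) :
    ∫ x, ⟪(Δ V) x, heatExtension φ θ x⟫ = ∫ x, ⟪V x, (Δ (heatExtension φ θ)) x⟫ := by
  haveI : CompleteSpace E := FiniteDimensional.complete ℝ E
  have hΔVc : Continuous (Δ V) := continuous_laplacian hV
  have hΔVb := norm_laplacian_le_of_norm_fderiv_fderiv_le hV h2
  have hΔφc : Continuous (Δ φ) := continuous_laplacian hφ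
  have hΔφs : HasCompactSupport (Δ φ) :=
    hφc.mono' fun x hx => by
      by_contra h
      exact hx (laplacian_eq_zero_of_notMem_tsupport h)
  have hSV2 : ContDiff ℝ 2 (heatExtension V θ) := UnboundedOperators.contDiff_heatExtension_of_bound hV.continuous h0 hθ
  calc ∫ x, ⟪(Δ V) x, heatExtension φ θ x⟫ = ∫ x, ⟪heatExtension (Δ V) θ x, φ x⟫ :=
        (integral_inner_heatExtension_comm_of_bound hΔVc.aestronglyMeasurable hΔVb hφ.continuous
          hφc hθ).symm
    _ = ∫ x, ⟪(Δ (heatExtension V θ)) x, φ x⟫ := by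
        refine integral_congr_ae (Eventually.of_forall fun x => ?_)
        beta_reduce
        rw [UnboundedOperators.laplacian_heatExtension_of_bounded hV h0 h1 h2 hθ x]
    _ = ∫ x, ⟪heatExtension V θ x, (Δ φ) x⟫ := integral_inner_laplacian_comm hSV2 hφ hφc
    _ = ∫ x, ⟪V x, heatExtension (Δ φ) θ x⟫ :=
        integral_inner_heatExtension_comm_of_bound hV.continuous.aestronglyMeasurable h0 hΔφc hΔφs hθ
    _ = ∫ x, ⟪V x, (Δ (heatExtension φ θ)) x⟫ := by
        refine integral_congr_ae (Eventually.of_forall fun x => ?_)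
        beta_reduce
        rw [UnboundedOperators.laplacian_heatExtension_of_hasCompactSupport hφ hφc θ x]

/-! ### The divergence of a bounded tensor against a caloric field -/

/-- `∫ ⟪∂ₑv, w⟫ = -∫ ⟪v, ∂ₑw⟫` for `v ∈ C¹` and `w ∈ C¹_c` (the trilinear identity
`integral_inner_convect_add_eq_zero` with the constant, divergence-free transport field `e`).
[folklore] -/
theorem integral_inner_fderiv_apply_const_eq_neg {v w : E → E} (hv : ContDiff ℝ 1 v)
    (hw : ContDiff ℝ 1 w) (hc : HasCompactSupport w) (e : E) :
    ∫ x, ⟪fderiv ℝ v x e, w x⟫ = -∫ x, ⟪v x, fderiv ℝ w x e⟫ := by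
  have h := integral_inner_convect_add_eq_zero (u := fun _ : E => e) contDiff_const hv hw hc
  have hdiv : ∀ x, VectorCalculus.divergence (fun _ : E => e) x = 0 := fun x => by
    simp [VectorCalculus.divergence]
  simp only [convect_apply, hdiv, zero_mul, integral_zero, add_zero] at h
  linarith

/-- **The divergence of a tensor field against a compactly supported field**: for
`W ∈ C¹(E; E →L[ℝ] E)` and `φ ∈ C¹_c(E; E)`,
`∫ ⟪Σᵢ ∂ᵢ(W eᵢ), φ⟫ = −∫ frobeniusPairing E (Dφ) W` (columnwise integration by parts).
[folklore] -/
theorem integral_inner_sum_fderiv_eq_neg {W : E → E →L[ℝ] E} (hW : ContDiff ℝ 1 W) {φ : E → E}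
    (hφ : ContDiff ℝ 1 φ) (hφc : HasCompactSupport φ) :
    ∫ x, ⟪∑ i, fderiv ℝ (fun y => W y (stdOrthonormalBasis ℝ E i)) x (stdOrthonormalBasis ℝ E i),
        φ x⟫ = -∫ x, frobeniusPairing E (fderiv ℝ φ x) (W x) := by
  set b := stdOrthonormalBasis ℝ E with hb
  set Wc : Fin (Module.finrank ℝ E) → E → E := fun i y => W y (b i) with hWc
  have hWi : ∀ i, ContDiff ℝ 1 (Wc i) := fun i => hW.clm_apply contDiff_const
  have hDWic : ∀ i, Continuous fun y => fderiv ℝ (Wc i) y (b i) := fun i =>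
    ((hWi i).continuous_fderiv one_ne_zero).clm_apply continuous_const
  have hDφc : ∀ v, Continuous fun y => fderiv ℝ φ y v := fun v =>
    (hφ.continuous_fderiv one_ne_zero).clm_apply continuous_const
  have hDφs : ∀ v, HasCompactSupport fun y => fderiv ℝ φ y v := fun v => hφc.fderiv_apply (𝕜 := ℝ) v
  have hcol : ∀ i, ∫ x, ⟪fderiv ℝ (Wc i) x (b i), φ x⟫ = -∫ x, ⟪Wc i x, fderiv ℝ φ x (b i)⟫ := fun i =>
    integral_inner_fderiv_apply_const_eq_neg (hWi i) hφ hφc (b i)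
  have iL : ∀ i, Integrable fun x => ⟪fderiv ℝ (Wc i) x (b i), φ x⟫ := fun i =>
    integrable_inner_of_hasCompactSupport_right (hDWic i) hφ.continuous hφc
  have iR : ∀ i, Integrable fun x => ⟪Wc i x, fderiv ℝ φ x (b i)⟫ := fun i =>
    integrable_inner_of_hasCompactSupport_right (hWi i).continuous (hDφc (b i)) (hDφs (b i))
  have hL : ∫ x, ⟪∑ i, fderiv ℝ (fun y => W y (b i)) x (b i), φ x⟫ =
      ∑ i, ∫ x, ⟪fderiv ℝ (Wc i) x (b i), φ x⟫ := by
    rw [← integral_finsetSum _ fun i _ => iL i]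
    refine integral_congr_ae (Eventually.of_forall fun x => ?_)
    beta_reduce
    rw [sum_inner]
  have hR : ∫ x, frobeniusPairing E (fderiv ℝ φ x) (W x) = ∑ i, ∫ x, ⟪Wc i x, fderiv ℝ φ x (b i)⟫ := by
    rw [← integral_finsetSum _ fun i _ => iR i]
    refine integral_congr_ae (Eventually.of_forall fun x => ?_)
    beta_reduce
    rw [frobeniusPairing_apply]
    exact Finset.sum_congr rfl fun i _ => real_inner_comm _ _
  rw [hL, hR, Finset.sum_congr rfl fun i _ => hcol i, Finset.sum_neg_distrib]

/-- **The divergence of a bounded tensor field against a caloric field.** For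
`W ∈ C¹(E; E →L[ℝ] E)` with `W`, `DW` bounded, `φ ∈ C¹_c(E; E)`, `0 < θ` and the standard frame
`e = stdOrthonormalBasis ℝ E`:
`∫ ⟪Σᵢ ∂ᵢ(W eᵢ), e^{θΔ}φ⟫ = −∫ frobeniusPairing E (D(e^{θΔ}φ)) W`
(for each `i`: symmetry of `e^{θΔ}`, `e^{θΔ}∂ᵢ = ∂ᵢe^{θΔ}` on the bounded field `W eᵢ`,
integration by parts against `φ`, symmetry, `e^{θΔ}∂ᵢφ = ∂ᵢ e^{θΔ}φ`). This is the caloric-test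
form of "`∫∫ f_k φ,_k`" in KNSS's weak Stokes system (3.1), §3 p. 7. [cite: KochNadirashviliSereginSverak2009, §3 p. 7 (arXiv:0709.3599v1)] -/
theorem integral_inner_sum_fderiv_heatExtension_eq_neg {W : E → E →L[ℝ] E} (hW : ContDiff ℝ 1 W)
    {C₀ C₁ : ℝ} (h0 : ∀ z, ‖W z‖ ≤ C₀) (h1 : ∀ z, ‖fderiv ℝ W z‖ ≤ C₁) {φ : E → E}
    (hφ : ContDiff ℝ 1 φ) (hφc : HasCompactSupport φ) {θ : ℝ} (hθ : 0 < θ) :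
    ∫ x, ⟪∑ i, fderiv ℝ (fun y => W y (stdOrthonormalBasis ℝ E i)) x (stdOrthonormalBasis ℝ E i),
        heatExtension φ θ x⟫ =
      -∫ x, frobeniusPairing E (fderiv ℝ (heatExtension φ θ) x) (W x) := by
  haveI : CompleteSpace E := FiniteDimensional.complete ℝ E
  set b := stdOrthonormalBasis ℝ E with hb
  have hC0 : 0 ≤ C₀ := (norm_nonneg _).trans (h0 0)
  -- the columns `Wᵢ = W eᵢ`
  set Wc : Fin (Module.finrank ℝ E) → E → E := fun i y => W y (b i) with hWc
  have hWi : ∀ i, ContDiff ℝ 1 (Wc i) := fun i => hW.clm_apply contDiff_const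
  have hWi0 : ∀ i y, ‖Wc i y‖ ≤ C₀ := fun i y =>
    (ContinuousLinearMap.le_opNorm _ _).trans (by rw [b.orthonormal.1 i, mul_one]; exact h0 y)
  have hDWi : ∀ i y v, fderiv ℝ (Wc i) y v = fderiv ℝ W y v (b i) := fun i y v => by
    simp only [hWc]
    rw [fderiv_clm_apply ((hW.differentiable one_ne_zero) y) (differentiableAt_const _)]
    simp
  have hWi1 : ∀ i y v, ‖fderiv ℝ (Wc i) y v‖ ≤ C₁ * ‖v‖ := fun i y v => by
    rw [hDWi]
    calc ‖fderiv ℝ W y v (b i)‖ ≤ ‖fderiv ℝ W y v‖ * ‖b i‖ := ContinuousLinearMap.le_opNorm _ _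
      _ ≤ ‖fderiv ℝ W y‖ * ‖v‖ * ‖b i‖ := by gcongr; exact ContinuousLinearMap.le_opNorm _ _
      _ ≤ C₁ * ‖v‖ := by rw [b.orthonormal.1 i, mul_one]; gcongr; exact h1 y
  have hWi1' : ∀ i y, ‖fderiv ℝ (Wc i) y (b i)‖ ≤ C₁ := fun i y =>
    (hWi1 i y (b i)).trans (by rw [b.orthonormal.1 i, mul_one])
  have hDWic : ∀ i, Continuous fun y => fderiv ℝ (Wc i) y (b i) := fun i =>
    ((hWi i).continuous_fderiv one_ne_zero).clm_apply continuous_const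
  -- the caloric test and its derivatives
  set Ψ : E → E := heatExtension φ θ with hΨ
  have hφint : Integrable φ := hφ.continuous.integrable_of_hasCompactSupport hφc
  have hΨint : Integrable Ψ := UnboundedOperators.integrable_heatExtension hφint hθ
  have hΨc : Continuous Ψ := (UnboundedOperators.contDiff_heatExtension_of_hasCompactSupport hφ hφc θ).continuous
  have hDφc : ∀ v, Continuous fun y => fderiv ℝ φ y v := fun v =>
    (hφ.continuous_fderiv one_ne_zero).clm_apply continuous_const
  have hDφs : ∀ v, HasCompactSupport fun y => fderiv ℝ φ y v := fun v => hφc.fderiv_apply (𝕜 := ℝ) v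
  have hDΨ : ∀ x v, fderiv ℝ Ψ x v = heatExtension (fun y => fderiv ℝ φ y v) θ x := fun x v =>
    UnboundedOperators.fderiv_heatExtension_apply_of_hasCompactSupport hφ hφc θ x v
  have hDΨint : ∀ v, Integrable fun x => fderiv ℝ Ψ x v := fun v => by
    simp only [hDΨ]
    exact UnboundedOperators.integrable_heatExtension
      ((hDφc v).integrable_of_hasCompactSupport (hDφs v)) hθ
  have hDΨc : ∀ v, Continuous fun x => fderiv ℝ Ψ x v := fun v =>
    ((UnboundedOperators.contDiff_heatExtension_of_hasCompactSupport hφ hφc θ).continuous_fderiv one_ne_zero).clm_apply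
      continuous_const
  -- each column
  have hcol : ∀ i, ∫ x, ⟪fderiv ℝ (Wc i) x (b i), Ψ x⟫ = -∫ x, ⟪Wc i x, fderiv ℝ Ψ x (b i)⟫ := by
    intro i
    have hSWi : ContDiff ℝ 1 (heatExtension (Wc i) θ) :=
      UnboundedOperators.contDiff_heatExtension_of_bound (hWi i).continuous (hWi0 i) hθ
    calc ∫ x, ⟪fderiv ℝ (Wc i) x (b i), Ψ x⟫
        = ∫ x, ⟪heatExtension (fun y => fderiv ℝ (Wc i) y (b i)) θ x, φ x⟫ :=
          (integral_inner_heatExtension_comm_of_bound (hDWic i).aestronglyMeasurable (hWi1' i)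
            hφ.continuous hφc hθ).symm
      _ = ∫ x, ⟪fderiv ℝ (heatExtension (Wc i) θ) x (b i), φ x⟫ := by
          refine integral_congr_ae (Eventually.of_forall fun x => ?_)
          beta_reduce
          rw [UnboundedOperators.fderiv_heatExtension_apply_of_bounded (hWi i) (hWi0 i) (hWi1' i) hθ x]
      _ = -∫ x, ⟪heatExtension (Wc i) θ x, fderiv ℝ φ x (b i)⟫ :=
          integral_inner_fderiv_apply_const_eq_neg hSWi hφ hφc (b i)
      _ = -∫ x, ⟪Wc i x, heatExtension (fun y => fderiv ℝ φ y (b i)) θ x⟫ := by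
          rw [integral_inner_heatExtension_comm_of_bound (hWi i).continuous.aestronglyMeasurable
            (hWi0 i) (hDφc (b i)) (hDφs (b i)) hθ]
      _ = -∫ x, ⟪Wc i x, fderiv ℝ Ψ x (b i)⟫ := by
          congr 1
          exact integral_congr_ae (Eventually.of_forall fun x => by beta_reduce; rw [hDΨ x (b i)])
  -- integrability of the columns' pairings
  have iL : ∀ i, Integrable fun x => ⟪fderiv ℝ (Wc i) x (b i), Ψ x⟫ := fun i => by
    refine (hΨint.norm.const_mul C₁).mono' ((hDWic i).inner hΨc).aestronglyMeasurable
      (Eventually.of_forall fun x => ?_)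
    exact (norm_inner_le_norm _ _).trans (mul_le_mul_of_nonneg_right (hWi1' i x) (norm_nonneg _))
  have iR : ∀ i, Integrable fun x => ⟪Wc i x, fderiv ℝ Ψ x (b i)⟫ := fun i => by
    refine ((hDΨint (b i)).norm.const_mul C₀).mono' ((hWi i).continuous.inner (hDΨc (b i))).aestronglyMeasurable
      (Eventually.of_forall fun x => ?_)
    exact (norm_inner_le_norm _ _).trans (mul_le_mul_of_nonneg_right (hWi0 i x) (norm_nonneg _))
  -- sum up
  have hL : ∫ x, ⟪∑ i, fderiv ℝ (fun y => W y (b i)) x (b i), Ψ x⟫ =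
      ∑ i, ∫ x, ⟪fderiv ℝ (Wc i) x (b i), Ψ x⟫ := by
    rw [← integral_finsetSum _ fun i _ => iL i]
    refine integral_congr_ae (Eventually.of_forall fun x => ?_)
    beta_reduce
    rw [sum_inner]
  have hR : ∫ x, frobeniusPairing E (fderiv ℝ Ψ x) (W x) = ∑ i, ∫ x, ⟪Wc i x, fderiv ℝ Ψ x (b i)⟫ := by
    rw [← integral_finsetSum _ fun i _ => iR i]
    refine integral_congr_ae (Eventually.of_forall fun x => ?_)
    beta_reduce
    rw [frobeniusPairing_apply]
    exact Finset.sum_congr rfl fun i _ => real_inner_comm _ _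
  rw [hL, hR, Finset.sum_congr rfl fun i _ => hcol i, Finset.sum_neg_distrib]

/-! ### A bounded curl-free field is orthogonal to the caloric extension of solenoidal tests -/

/-- **The heat flow preserves the symmetry of the derivative**: if `G ∈ C¹` with `G`, `DG`
bounded and `⟪DG(x)v, w⟫ = ⟪DG(x)w, v⟫`, then `e^{θΔ}G` has the same symmetry
(`D e^{θΔ}G = e^{θΔ} DG`). [folklore] -/
theorem inner_fderiv_heatExtension_comm_of_fderiv_symm {G : E → E} (hG : ContDiff ℝ 1 G)
    {C₀ C₁ : ℝ} (h0 : ∀ z, ‖G z‖ ≤ C₀) (h1 : ∀ z, ‖fderiv ℝ G z‖ ≤ C₁)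
    (hsymm : ∀ x v w, ⟪fderiv ℝ G x v, w⟫ = ⟪fderiv ℝ G x w, v⟫) {θ : ℝ} (hθ : 0 < θ)
    (x v w : E) :
    ⟪fderiv ℝ (heatExtension G θ) x v, w⟫ = ⟪fderiv ℝ (heatExtension G θ) x w, v⟫ := by
  haveI : CompleteSpace E := FiniteDimensional.complete ℝ E
  have h1v : ∀ v z, ‖fderiv ℝ G z v‖ ≤ C₁ * ‖v‖ := fun v z =>
    (ContinuousLinearMap.le_opNorm _ _).trans (mul_le_mul_of_nonneg_right (h1 z) (norm_nonneg _))
  have hDc : ∀ v, Continuous fun z => fderiv ℝ G z v := fun v =>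
    (hG.continuous_fderiv one_ne_zero).clm_apply continuous_const
  -- `⟪D(e^{θΔ}G)(x) v, w⟫ = e^{θΔ}(⟪DG · v, w⟫)(x)`
  have key : ∀ v w, ⟪fderiv ℝ (heatExtension G θ) x v, w⟫ =
      heatExtension (fun z => ⟪fderiv ℝ G z v, w⟫) θ x := by
    intro v w
    rw [UnboundedOperators.fderiv_heatExtension_apply_of_bounded hG h0 (h1v v) hθ x]
    have hc := UnboundedOperators.heatExtension_clm_comp_of_bound (innerSL ℝ w) (hDc v) (h1v v) hθ x
    simp only [innerSL_apply_apply] at hc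
    rw [show ⟪heatExtension (fun z => fderiv ℝ G z v) θ x, w⟫ =
      ⟪w, heatExtension (fun z => fderiv ℝ G z v) θ x⟫ from real_inner_comm _ _, ← hc]
    congr 1
    funext z
    exact real_inner_comm _ _
  rw [key, key]
  congr 1
  funext z
  exact hsymm z v w

/-- **A bounded field with bounded symmetric derivative is orthogonal to the caloric extensions
of solenoidal test fields.** If `G ∈ C¹(E; E)` with `G`, `DG` bounded and `DG` symmetric
(`curl G = 0`), then for every smooth compactly supported divergence-free `φ` and `0 < θ`,
`∫ ⟪G, e^{θΔ}φ⟫ = 0`: by symmetry this is `∫ ⟪e^{θΔ}G, φ⟫`; `e^{θΔ}G` is smooth with symmetric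
derivative, hence the gradient of its segment potential (`hasGradientAt_segmentIntegral`), and
`∫ ⟪∇q, φ⟫ = −∫ q div φ = 0`. This is how the pressure gradient of the mollified equation drops
out of the caloric duality (KNSS 2009, §3: "`∇_y h(y, t)` … harmonic"; Fabes–Jones–Rivière 1972,
Thm. 2.1). [cite: KochNadirashviliSereginSverak2009, §3 Lemma 3.1 proof p. 7 (arXiv:0709.3599v1)] -/
theorem integral_inner_heatExtension_eq_zero_of_fderiv_symm {G : E → E} (hG : ContDiff ℝ 1 G)
    {C₀ C₁ : ℝ} (h0 : ∀ z, ‖G z‖ ≤ C₀) (h1 : ∀ z, ‖fderiv ℝ G z‖ ≤ C₁)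
    (hsymm : ∀ x v w, ⟪fderiv ℝ G x v, w⟫ = ⟪fderiv ℝ G x w, v⟫) {φ : E → E}
    (hφ : FunctionSpaces.IsTestFunctionOn (⊤ : Opens E) φ) (hdiv : VectorCalculus.IsDivFree φ)
    {θ : ℝ} (hθ : 0 < θ) :
    ∫ x, ⟪G x, heatExtension φ θ x⟫ = 0 := by
  haveI : CompleteSpace E := FiniteDimensional.complete ℝ E
  set SG : E → E := heatExtension G θ with hSG
  have hSGs : ContDiff ℝ ∞ SG := UnboundedOperators.contDiff_heatExtension_of_bound hG.continuous h0 hθ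
  have hSGsymm : ∀ x v w, ⟪fderiv ℝ SG x v, w⟫ = ⟪fderiv ℝ SG x w, v⟫ := fun x v w =>
    inner_fderiv_heatExtension_comm_of_fderiv_symm hG h0 h1 hsymm hθ x v w
  -- the segment potential of `e^{θΔ}G`
  set q : E → ℝ := fun y => ∫ σ in (0 : ℝ)..1, ⟪SG (σ • y), y⟫ with hq
  have hgrad : ∀ x, HasGradientAt q (SG x) x := fun x => hasGradientAt_segmentIntegral hSGs hSGsymm x
  have hqd : ∀ x, HasFDerivAt q (InnerProductSpace.toDual ℝ E (SG x)) x := fun x =>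
    (hgrad x).hasFDerivAt
  have hq1 : ContDiff ℝ 1 q := by
    refine contDiff_one_iff_fderiv.2 ⟨fun x => (hqd x).differentiableAt, ?_⟩
    have : fderiv ℝ q = fun x => InnerProductSpace.toDual ℝ E (SG x) := funext fun x => (hqd x).fderiv
    rw [this]
    exact (InnerProductSpace.toDual ℝ E).continuous.comp hSGs.continuous
  have hgq : ∀ x, gradient q x = SG x := fun x => (hgrad x).gradient
  have hφ1 : ContDiff ℝ 1 φ := contDiff_infty.1 hφ.contDiff 1
  calc ∫ x, ⟪G x, heatExtension φ θ x⟫ = ∫ x, ⟪SG x, φ x⟫ :=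
        (integral_inner_heatExtension_comm_of_bound hG.continuous.aestronglyMeasurable h0
          hφ.contDiff.continuous hφ.hasCompactSupport hθ).symm
    _ = ∫ x, ⟪gradient q x, φ x⟫ :=
        integral_congr_ae (Eventually.of_forall fun x => by beta_reduce; rw [hgq x])
    _ = -∫ x, q x * VectorCalculus.divergence φ x :=
        integral_inner_gradient_eq_neg_integral_mul_divergence hq1 hφ1 hφ.hasCompactSupport
    _ = 0 := by simp [hdiv _]

end Literature.Analysis.FluidPDE

end
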